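import Mathlib.NumberTheory.LSeries.RiemannZeta
import Mathlib.Analysis.Calculus.IteratedDeriv.Defs
import Mathlib.Algebra.Polynomial.Splits
import Mathlib.Analysis.SpecialFunctions.Complex.Log
import HarnessLib

-- provenance: harness21/H21/H21/Prelude/AntSieve/RiemannXi.lean @ efa73f9 (interim HEAD d8f2665); M5 mechanical rewrite
/-!
# Riemann's `ξ` and `Ξ` functions, Jensen polynomials, Keiper–Li coefficients

Trunk: AntSieve (analytic number theory / sieves), concept C2 of `H21/Outlines/AntSieve.md`;
notion `riemann_xi_Xi`.

## Contents

* `Literature.riemannXi s = 1/2 + s (s - 1) / 2 * Λ₀(s)`: Riemann's entire function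
  `ξ(s) = ½ s (s − 1) π^{-s/2} Γ(s/2) ζ(s)`. We build it from Mathlib's pole-free completed zeta
  function `completedRiemannZeta₀` (`Λ₀(s) = Λ(s) + 1/s + 1/(1 - s)`), so that
  `½ s(s−1) Λ(s) = ½ s(s−1) Λ₀(s) − (s−1)/2 + s/2 = ½ + ½ s(s−1) Λ₀(s)`; this makes `ξ` entire
  *by construction* (no removable singularities to patch).
* `Literature.riemannXiUpper z = ξ(1/2 + i z)`: Riemann's `Ξ(z)`, even, real on the real axis; RH says all
  its zeros are real.
* `Literature.xiTaylorCoeff n`: the Taylor coefficients `γ(n)` of Griffin–Ono–Rolen–Zagier,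
  `(−1 + 4 z²) Λ(1/2 + z) = 8 ξ(1/2 + z) = ∑ γ(n) z^{2n} / n!`.
* `Literature.jensenPoly γ d n = ∑_{j ≤ d} (d choose j) γ(n + j) X^j`: Jensen polynomials of a real
  sequence; "hyperbolic" is expressed with Mathlib's `Polynomial.Splits` over `ℝ`.
* `Literature.keiperLiCoeff n = (1/(n−1)!) dⁿ/dsⁿ [s^{n−1} log ξ(s)]|_{s=1}`: the Keiper–Li coefficients.

Mathlib has `riemannZeta`, `completedRiemannZeta`, `completedRiemannZeta₀`,
`completedRiemannZeta₀_one_sub`, `differentiable_completedZeta₀` and `RiemannHypothesis`, but no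
`ξ`/`Ξ`; we searched for `riemannXi`/`Xi` and found nothing.

## References

* B. Riemann, *Ueber die Anzahl der Primzahlen unter einer gegebenen Grösse*, 1859.
* X.-J. Li, *The positivity of a sequence of numbers and the Riemann hypothesis*,
  J. Number Theory 65 (1997), Thm. 1; J. B. Keiper, Math. Comp. 58 (1992).
* M. Griffin, K. Ono, L. Rolen, D. Zagier, *Jensen polynomials for the Riemann zeta function and
  other sequences*, PNAS 116 (2019), §1 (GORZ).
* E. C. Titchmarsh, *The theory of the Riemann zeta-function*, 2nd ed., §2.1, §10.1.
-/

noncomputable section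

open Complex Polynomial
open scoped Nat

namespace Literature.NumberTheory.LFunctions

/-! ## The functions `ξ` and `Ξ` -/

/-- Riemann's `ξ` function, `ξ(s) = ½ s (s − 1) π^{-s/2} Γ(s/2) ζ(s)` (Riemann 1859; Titchmarsh
§2.1 eq. (2.1.12)). Defined as `1/2 + s (s − 1)/2 · Λ₀(s)` with Mathlib's entire
`completedRiemannZeta₀`, which agrees with `½ s(s−1) Λ(s)` for `s ≠ 0, 1`
(`riemannXi_eq_mul_completedRiemannZeta`) and is entire by construction. [cite: Riemann1859] -/
def riemannXi (s : ℂ) : ℂ :=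
  1 / 2 + s * (s - 1) / 2 * completedRiemannZeta₀ s

/-- Riemann's `Ξ` function, `Ξ(z) = ξ(1/2 + i z)` (Riemann 1859; Titchmarsh §10.1). It is an even
entire function, real on the real axis, and the Riemann hypothesis is the assertion that all of
its zeros are real. [cite: Riemann1859] -/
def riemannXiUpper (z : ℂ) : ℂ :=
  riemannXi (1 / 2 + I * z)

/-- `ξ(s) = ½ s (s − 1) Λ(s)` away from the poles `s = 0, 1` of `Λ` (Titchmarsh §2.1). [folklore] -/
theorem riemannXi_eq_mul_completedRiemannZeta {s : ℂ} (hs : s ≠ 0) (hs' : s ≠ 1) :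
    riemannXi s = s * (s - 1) / 2 * completedRiemannZeta s := by
  have h1 : (1 - s) ≠ 0 := sub_ne_zero.mpr (Ne.symm hs')
  rw [riemannXi, completedRiemannZeta_eq]
  field_simp
  ring

/-- `ξ` is entire (Riemann 1859; Titchmarsh §2.1). [cite: Riemann1859] -/
theorem differentiable_riemannXi : Differentiable ℂ riemannXi := by
  unfold riemannXi
  exact (differentiable_const _).add
    (((differentiable_id.mul (differentiable_id.sub (differentiable_const _))).div_const 2).mul
      differentiable_completedZeta₀)

/-- The functional equation `ξ(1 − s) = ξ(s)` (Riemann 1859; Titchmarsh eq. (2.1.13)). [cite: Riemann1859] -/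
theorem riemannXi_one_sub (s : ℂ) : riemannXi (1 - s) = riemannXi s := by
  simp only [riemannXi, completedRiemannZeta₀_one_sub]
  ring

/-- `ξ(0) = 1/2` (Titchmarsh §2.1). [folklore] -/
theorem riemannXi_zero : riemannXi 0 = 1 / 2 := by
  simp [riemannXi]

/-- `ξ(1) = 1/2` (Titchmarsh §2.1). [folklore] -/
theorem riemannXi_one : riemannXi 1 = 1 / 2 := by
  simp [riemannXi]

/-- Schwarz reflection: `ξ(conj s) = conj (ξ s)`, since `ξ` is real on the real axis
(Titchmarsh §2.1). [cite: Titchmarsh1986, §2.1] -/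
def riemannXi_conj : Prop :=
  ∀ (s : ℂ),
    riemannXi (starRingEnd ℂ s) = starRingEnd ℂ (riemannXi s)

/-- `Ξ` is even: `Ξ(−z) = Ξ(z)`, from the functional equation (Titchmarsh §10.1). [folklore] -/
theorem riemannXiUpper_neg (z : ℂ) : riemannXiUpper (-z) = riemannXiUpper z := by
  rw [riemannXiUpper, riemannXiUpper, ← riemannXi_one_sub]
  congr 1
  ring

/-- `Ξ` is real on the real axis (Titchmarsh §10.1). [cite: Titchmarsh1986, §10.1] -/
def im_riemannXiUpper_ofReal : Prop :=
  ∀ (t : ℝ),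
    (riemannXiUpper t).im = 0

/-- The zeros of `ξ` are exactly the nontrivial zeros of `ζ`, i.e. the zeros of `ζ` in the
critical strip `0 < re s < 1` (Titchmarsh §2.12; uses `ζ(s) ≠ 0` on `re s = 1` and the absence
of zeros of `Γ`). [cite: Titchmarsh1986, §2.12] -/
def riemannXi_eq_zero_iff : Prop :=
  ∀ (s : ℂ),
    riemannXi s = 0 ↔ riemannZeta s = 0 ∧ 0 < s.re ∧ s.re < 1

/-- Riemann's formulation of RH: the Riemann hypothesis holds iff every zero of `Ξ` is real
(Riemann 1859; Titchmarsh §10.1). [cite: Riemann1859] -/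
def riemannHypothesis_iff_im_eq_zero_of_riemannXiUpper_eq_zero : Prop :=
  RiemannHypothesis ↔ ∀ z : ℂ, riemannXiUpper z = 0 → z.im = 0

/-! ## Taylor coefficients at `1/2` and Jensen polynomials (GORZ 2019) -/

/-- The Taylor coefficients `γ(n)` of Griffin–Ono–Rolen–Zagier (PNAS 2019, eq. (1)):
`(−1 + 4z²) Λ(1/2 + z) = ∑_{n ≥ 0} γ(n) z^{2n} / n!`. Since `(−1 + 4z²) Λ(1/2 + z) = 8 ξ(1/2 + z)`,
`γ(n) = 8 · n! · ξ^{(2n)}(1/2) / (2n)!`; the value is real (`ξ` is real on `ℝ`) and we take the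
real part. [cite: PNAS2019, eq. (1] -/
def xiTaylorCoeff (n : ℕ) : ℝ :=
  (8 * (n ! : ℂ) / ((2 * n)! : ℂ) * iteratedDeriv (2 * n) riemannXi (1 / 2)).re

/-- The Jensen polynomial of degree `d` and shift `n` of a real sequence `γ`
(GORZ, PNAS 2019, §1): `J^{d,n}_γ(X) = ∑_{j=0}^{d} (d choose j) γ(n + j) X^j`. It is called
*hyperbolic* when all its roots are real, i.e. `Polynomial.Splits (jensenPoly γ d n)` over `ℝ`. [cite: PNAS2019, §1] -/
def jensenPoly (γ : ℕ → ℝ) (d n : ℕ) : ℝ[X] :=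
  ∑ j ∈ Finset.range (d + 1), C ((d.choose j : ℝ) * γ (n + j)) * X ^ j

/-- The Jensen polynomial `J^{d,n}_γ` has degree `d` provided `γ(n + d) ≠ 0` (GORZ 2019, §1). [cite: GORZ2019, §1] -/
theorem natDegree_jensenPoly (γ : ℕ → ℝ) (d n : ℕ) (h : γ (n + d) ≠ 0) :
    (jensenPoly γ d n).natDegree = d := by
  apply le_antisymm
  · apply natDegree_sum_le_of_forall_le
    intro j hj
    refine (natDegree_C_mul_X_pow_le _ _).trans ?_
    simpa [Nat.lt_succ_iff] using hj
  · apply le_natDegree_of_ne_zero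
    rw [jensenPoly, finsetSum_coeff]
    simp only [coeff_C_mul_X_pow]
    rw [Finset.sum_eq_single d]
    · simpa using h
    · intro b _ hb; simp [Ne.symm hb]
    · intro hd; simp at hd

/-- The GORZ Taylor coefficients are positive: `γ(n) > 0` for all `n` (GORZ, PNAS 2019, §1;
classical, e.g. from Riemann's integral representation of `Ξ`, Titchmarsh §10.1). [cite: PNAS2019, §1] -/
def xiTaylorCoeff_pos : Prop :=
  ∀ (n : ℕ),
    0 < xiTaylorCoeff n

/-! ## Keiper–Li coefficients -/

/-- The Keiper–Li coefficients `λ_n = (1/(n−1)!) dⁿ/dsⁿ [s^{n−1} log ξ(s)]|_{s=1}` for `n ≥ 1`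
(Li 1997, eq. (1.4); Keiper 1992). We use the principal branch `Complex.log ∘ riemannXi`, which
is holomorphic near `s = 1` since `ξ(1) = 1/2 > 0`; Li's normalisation `ξ_Li = 2 ξ` changes
`log ξ` by the constant `log 2`, which does not affect `λ_n` because `dⁿ/dsⁿ s^{n−1} = 0`. The
value is real and we take the real part. Junk value at `n = 0`: the formula reads
`(d⁰/ds⁰ [s^{0-1} log ξ(s)])(1) / (0-1)! = log ξ(1) = −log 2` with `ℕ`-subtraction; only `n ≥ 1`
is meaningful. Li's criterion: RH `↔ ∀ n ≥ 1, 0 ≤ λ_n`. [cite: Li1997, eq. (1.4] -/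
def keiperLiCoeff (n : ℕ) : ℝ :=
  (iteratedDeriv n (fun s : ℂ ↦ s ^ (n - 1) * Complex.log (riemannXi s)) 1 / ((n - 1)! : ℂ)).re

end Literature.NumberTheory.LFunctions
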